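import Literature.NumberTheory.Transcendental.KhovanskiiTrdegBound
import Literature.NumberTheory.Transcendental.SchanuelEclEmptyProofs
import HarnessLib

/-!
# RootDecomp1J — Khovanskii points are hereditary blocks: certified members of the pair hull `𝓚₂`
(lens 3, NODE v9 §31–§32; supports the declared residual K₃ = `SchanuelOverPairClosedFields`, stmt-Schanuel-30523)

The round-6 split of route `RootDecomp1J` cut the residual `K₂ = Rel(⊤|𝓚)` (𝓚 = the curve hull of the
EL-span) into `G₂ = Rel(𝓚₂|𝓚)` (stmt-Schanuel-30522) and the declared residual `K₃ = Rel(⊤|𝓚₂)`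
(stmt-Schanuel-30523), where the PAIR HULL `𝓚₂ = ⨆ₙ (E ↦ E ⊔ span_ℚ{coordinates of hereditary blocks of
size ≤ 2 over E})^[n+1] 𝓚` is written out verbatim in the items with the HEREDITARY-BLOCK clause

  `∃ Y : Finset ℂ, ↑Y ⊆ ↑E ∧ ∀ T ⊇ Y, ∀ r (ρ : Fin r → Fin N), (∀ j, w j ∈ span_ℚ (↑T ∪ range (w ∘ ρ))) →
     trdeg_{ℚ(T, e^T)} ℚ(T, e^T)(w, e^w) ≤ r`.

This file gives the residual's base CERTIFIED MEMBERS beyond curve points: by the Khovanskii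
transcendence bound (Kirby 2010, Prop. 4.7 / Lemma 4.8 [cite: Kirby2010, Prop. 4.7], landed as
`Literature.NumberTheory.Transcendental.KhovanskiiBound.trdeg_adjoin_le_of_khovanskii`), every
non-degenerate solution `x̄` of an `n × n` exponential-polynomial system `fᵢ(x̄, e^{x̄}) = 0` with
coefficients in `ℤ[Y, e^Y]`, `Y ⊂ E` finite, and non-vanishing exponential Jacobian
`det(∂ⱼ fᵢ + X_{n+j} ∂_{n+j} fᵢ)(x̄, e^{x̄})` satisfies the hereditary-block clause over `E` with witness
set `Y` (`hblock_of_khovanskii`); hence its coordinates lie in the `N`-block step of `E` for every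
`N ≥ n` (`mem_blockStep_of_khovanskii`), in every level-hull `⨆ₙ step^[n+1] E'` with `E ≤ E'`
(`mem_blockHull_of_khovanskii`), and — for `n ≤ 2` and `Y ⊂ 𝓚` — in K₃'s base `𝓚₂` literally
(`mem_pairHull_curveHull_of_khovanskii`). Finally every exponentially algebraic number
(`a ∈ Literature.NumberTheory.Transcendental.ecl ∅`, Kirby's closure) is a coordinate of a tuple
satisfying the clause over `⊥` (`exists_hblock_of_mem_ecl_empty`) — the kernel of NODE v9's exhaustion
`ecl ∅ = ⋃_N 𝓚_N(⊥)`.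
Port of `HOME/decomp-schanuel-lens-3/v9/prover/RootDecomp1JKhovanskiiBlocks.port.lean` (= node
`PeriodFlagSplit.hblock_of_khovanskii`, §32, with the node's `HBlock`/`blockStep` unfolded to the items'
literal clause); the folklore `trdeg` bookkeeping (`trdeg_adjoin_union_eq_add`, `trdeg_adjoin_le_cardinalMk`, twins of
`RootDecomp1DFlagSplit`) is inlined as private copies so that the file imports NO route file and §0 proves
only the three tools with no landed twin. This file defines nothing; 0 sorry.
-/

set_option linter.dupNamespace false

noncomputable section

open Complex IntermediateField

namespace Summit.Schanuel.Schanuel.Theorems.RootDecomp1JKhovanskiiBlocks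

open Literature.NumberTheory.Transcendental (expPDeriv)

/-- Tower law for a union of generating sets (private copy of the route-bound twin
`RootDecomp1DFlagSplit.trdeg_adjoin_union_eq_add`, inlined so that this file imports no route file). -/
private theorem trdeg_adjoin_union_eq_add {K E : Type*} [Field K] [Field E] [Algebra K E] (S T : Set E) :
    Algebra.trdeg K (adjoin K (S ∪ T)) =
      Algebra.trdeg K (adjoin K S) + Algebra.trdeg (adjoin K S) (adjoin (adjoin K S) T) := by
  have htower := trdeg_add_eq K (adjoin K S) (A := adjoin (adjoin K S) T)
  have heq : Algebra.trdeg K (adjoin (adjoin K S) T) = Algebra.trdeg K (adjoin K (S ∪ T)) := by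
    rw [← (equivOfEq (adjoin_adjoin_left K S T)).trdeg_eq]
    rfl
  rw [← heq, htower]

/-- `trdeg_F F(S) ≤ #S` (private copy of the route-bound twin `RootDecomp1DFlagSplit.trdeg_adjoin_le_cardinalMk`). -/
private theorem trdeg_adjoin_le_cardinalMk {F E : Type*} [Field F] [Field E] [Algebra F E] (S : Set E) :
    Algebra.trdeg F ↥(adjoin F S) ≤ Cardinal.mk S := by
  haveI := Literature.NumberTheory.Transcendental.isAlgebraic_adjoin_over_algebraAdjoin (F := F) S
  exact (Algebra.IsAlgebraic.trdeg_le_cardinalMk F (((↑) : adjoin F S → E) ⁻¹' S)).trans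
    (Cardinal.mk_preimage_of_injective _ _ Subtype.val_injective)

/-! ### §0 Folklore tools -/

/-- If `w ∈ span_ℚ b` then `w ∈ F` and `e^w` is algebraic over `F`, for every field `F ⊇ ℚ(b, e^b)`
(`e^w` is an `N`-th root of `e^{Nw} ∈ ℚ(e^b)`). [folklore] -/
theorem mem_and_isAlgebraic_exp_of_mem_span {ι : Type*} (b : ι → ℂ) {w : ℂ}
    (hw : w ∈ Submodule.span ℚ (Set.range b)) (F : IntermediateField ℚ ℂ)
    (hF : adjoin ℚ (Set.range b ∪ Set.range (cexp ∘ b)) ≤ F) :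
    w ∈ F ∧ IsAlgebraic F (cexp w) := by
  obtain ⟨N, hN, hNmem⟩ :=
    Literature.NumberTheory.Transcendental.exists_nsmul_mem_span_int b hw
  have hmem := Literature.NumberTheory.Transcendental.mem_adjoin_of_mem_span_int b hNmem
  have hNq : ((N : ℚ) : ℂ) ≠ 0 := by exact_mod_cast hN
  refine ⟨?_, ?_⟩
  · have h1 : ((N : ℚ) : ℂ)⁻¹ * (((N : ℚ)) • w) = w := by
      rw [Rat.smul_def, ← mul_assoc, inv_mul_cancel₀ hNq, one_mul]
    rw [← h1]
    exact mul_mem (inv_mem (by simp)) (hF hmem.1)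
  · have hpow : cexp w ^ N = cexp ((N : ℚ) • w) := by
      rw [Rat.smul_def, Rat.cast_natCast, Complex.exp_nat_mul]
    refine IsAlgebraic.of_pow (Nat.pos_of_ne_zero hN) ?_
    rw [hpow]
    exact isAlgebraic_algebraMap (⟨_, hF hmem.2⟩ : F)

/-- Set form: for `u ∈ span_ℚ A` and any field `F ⊇ ℚ(A, e^A)`: `u ∈ F` and `e^u` is algebraic over `F`.
[folklore] -/
theorem mem_and_isAlgebraic_exp_of_mem_span_set {A : Set ℂ} {u : ℂ} (hu : u ∈ Submodule.span ℚ A)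
    (F : IntermediateField ℚ ℂ) (hF : adjoin ℚ (A ∪ cexp '' A) ≤ F) : u ∈ F ∧ IsAlgebraic F (cexp u) := by
  refine mem_and_isAlgebraic_exp_of_mem_span (Subtype.val : A → ℂ) (by rwa [Subtype.range_val]) F ?_
  rw [Set.range_comp, Subtype.range_val]
  exact hF

/-- Enlarging the base field `ℚ(G₀)` by generators ALGEBRAIC over it does not lower relative
transcendence degrees: `trdeg_{ℚ(G₀)} ℚ(G₀)(A) ≤ trdeg_{ℚ(G₀ ∪ G₁)} ℚ(G₀ ∪ G₁)(A)`. [folklore] -/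
theorem reltrdeg_le_of_isAlgebraic (G₀ G₁ A : Set ℂ) (halg : ∀ u ∈ G₁, IsAlgebraic (adjoin ℚ G₀) u)
    (hfin : Algebra.trdeg ℚ ↥(adjoin ℚ G₀) < Cardinal.aleph0) :
    Algebra.trdeg ↥(adjoin ℚ G₀) ↥(adjoin ↥(adjoin ℚ G₀) A) ≤
      Algebra.trdeg ↥(adjoin ℚ (G₀ ∪ G₁)) ↥(adjoin ↥(adjoin ℚ (G₀ ∪ G₁)) A) := by
  obtain ⟨d, hd⟩ := Cardinal.lt_aleph0.1 hfin
  -- `trdeg_ℚ ℚ(S ∪ T) = trdeg_ℚ ℚ(S)` when `T` is algebraic over `ℚ(S)` (tower law + `trdeg = 0`)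
  have hunion : ∀ S T : Set ℂ, (∀ u ∈ T, IsAlgebraic (adjoin ℚ S) u) →
      Algebra.trdeg ℚ ↥(adjoin ℚ (S ∪ T)) = Algebra.trdeg ℚ ↥(adjoin ℚ S) := by
    intro S T hT
    haveI : Algebra.IsAlgebraic (adjoin ℚ S) (adjoin (adjoin ℚ S) T) :=
      IntermediateField.isAlgebraic_adjoin fun u hu => (hT u hu).isIntegral
    have h0 : Algebra.trdeg (adjoin ℚ S) (adjoin (adjoin ℚ S) T) = 0 := trdeg_eq_zero
    calc Algebra.trdeg ℚ ↥(adjoin ℚ (S ∪ T))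
        = Algebra.trdeg ℚ ↥(adjoin ℚ S) + Algebra.trdeg (adjoin ℚ S) (adjoin (adjoin ℚ S) T) :=
          trdeg_adjoin_union_eq_add S T
      _ = Algebra.trdeg ℚ ↥(adjoin ℚ S) := by rw [h0, add_zero]
  have h01 : Algebra.trdeg ℚ ↥(adjoin ℚ (G₀ ∪ G₁)) = Algebra.trdeg ℚ ↥(adjoin ℚ G₀) := hunion G₀ G₁ halg
  -- algebraicity over `ℚ(G₀)` passes to the larger field `ℚ(G₀ ∪ A)`
  have halg' : ∀ u ∈ G₁, IsAlgebraic (adjoin ℚ (G₀ ∪ A)) u := by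
    intro u hu
    obtain ⟨p, hp0, hpu⟩ := halg u hu
    have hle : adjoin ℚ G₀ ≤ adjoin ℚ (G₀ ∪ A) := adjoin.mono _ _ _ Set.subset_union_left
    refine ⟨p.map (IntermediateField.inclusion hle).toRingHom, ?_, ?_⟩
    · exact (Polynomial.map_ne_zero_iff (IntermediateField.inclusion_injective hle)).mpr hp0
    · rw [Polynomial.aeval_def, Polynomial.eval₂_map]
      have hc : (algebraMap ↥(adjoin ℚ (G₀ ∪ A)) ℂ).comp (IntermediateField.inclusion hle).toRingHom =
          algebraMap ↥(adjoin ℚ G₀) ℂ := RingHom.ext fun _ => rfl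
      rw [hc, ← Polynomial.aeval_def]
      exact hpu
  have h0A1 : Algebra.trdeg ℚ ↥(adjoin ℚ ((G₀ ∪ A) ∪ G₁)) = Algebra.trdeg ℚ ↥(adjoin ℚ (G₀ ∪ A)) :=
    hunion _ G₁ halg'
  have hset : (G₀ ∪ G₁) ∪ A = (G₀ ∪ A) ∪ G₁ := Set.union_right_comm _ _ _
  have key : Algebra.trdeg ↥(adjoin ℚ G₀) ↥(adjoin ↥(adjoin ℚ G₀) A) + (d : Cardinal) ≤
      Algebra.trdeg ↥(adjoin ℚ (G₀ ∪ G₁)) ↥(adjoin ↥(adjoin ℚ (G₀ ∪ G₁)) A) + (d : Cardinal) := by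
    apply le_of_eq
    calc Algebra.trdeg ↥(adjoin ℚ G₀) ↥(adjoin ↥(adjoin ℚ G₀) A) + (d : Cardinal)
        = Algebra.trdeg ℚ ↥(adjoin ℚ G₀) + Algebra.trdeg ↥(adjoin ℚ G₀) ↥(adjoin ↥(adjoin ℚ G₀) A) := by
          rw [hd, add_comm]
      _ = Algebra.trdeg ℚ ↥(adjoin ℚ (G₀ ∪ A)) := (trdeg_adjoin_union_eq_add G₀ A).symm
      _ = Algebra.trdeg ℚ ↥(adjoin ℚ ((G₀ ∪ A) ∪ G₁)) := h0A1.symm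
      _ = Algebra.trdeg ℚ ↥(adjoin ℚ ((G₀ ∪ G₁) ∪ A)) := by rw [hset]
      _ = Algebra.trdeg ℚ ↥(adjoin ℚ (G₀ ∪ G₁)) +
            Algebra.trdeg ↥(adjoin ℚ (G₀ ∪ G₁)) ↥(adjoin ↥(adjoin ℚ (G₀ ∪ G₁)) A) :=
          trdeg_adjoin_union_eq_add _ A
      _ = Algebra.trdeg ↥(adjoin ℚ (G₀ ∪ G₁)) ↥(adjoin ↥(adjoin ℚ (G₀ ∪ G₁)) A) + (d : Cardinal) := by
          rw [h01, hd, add_comm]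
  exact (Cardinal.add_nat_le_add_nat_iff d).1 key

/-- The witness field `ℚ(T, e^T)` of a finite set has finite transcendence degree. [folklore] -/
theorem trdeg_witnessField_lt_aleph0 (T : Finset ℂ) :
    Algebra.trdeg ℚ ↥(adjoin ℚ ((↑T : Set ℂ) ∪ cexp '' ↑T)) < Cardinal.aleph0 := by
  refine lt_of_le_of_lt (trdeg_adjoin_le_cardinalMk _) ?_
  rw [Cardinal.lt_aleph0_iff_set_finite]
  exact (Finset.finite_toSet T).union ((Finset.finite_toSet T).image _)

/-! ### §1 Khovanskii points satisfy the hereditary-block clause (NODE v9 `hblock_of_khovanskii`) -/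

/-- **Khovanskii points are hereditary blocks.** A non-degenerate solution `x̄` of an `n × n`
exponential-polynomial system `fᵢ(x̄, e^{x̄}) = 0` (`i < n`), coefficients in `ℤ[Y, e^Y]` with `Y ⊂ E`
finite, exponential Jacobian `det(∂ⱼ fᵢ + X_{n+j} ∂_{n+j} fᵢ)(x̄, e^{x̄}) ≠ 0`, satisfies the items'
hereditary-block clause over `E` with witness set `Y`: for every finite `T ⊇ Y` and every sub-tuple
`x ∘ ρ` of length `r` with `x̄ ⊂ span_ℚ(T ∪ x ∘ ρ)`, `trdeg_{ℚ(T,e^T)} ℚ(T,e^T)(x̄, e^{x̄}) ≤ r`. Proof: the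
Khovanskii bound [cite: Kirby2010, Prop. 4.7] for the Γ-field `L = ℚ(Λ, e^Λ)`, `Λ = span_ℚ T`
(`KhovanskiiBound.trdeg_adjoin_le_of_khovanskii`), pulled down to the subfield `ℚ(T, e^T)` over which
`L` is algebraic (`reltrdeg_le_of_isAlgebraic`). -/
theorem hblock_of_khovanskii {E : Submodule ℚ ℂ} (Y : Finset ℂ) (hY : (↑Y : Set ℂ) ⊆ (E : Set ℂ))
    {n : ℕ} {x : Fin n → ℂ} {f : Fin n → MvPolynomial (Fin n ⊕ Fin n) ℂ}
    (hcoeff : ∀ i m, (f i).coeff m ∈ Subring.closure ((↑Y : Set ℂ) ∪ cexp '' ↑Y))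
    (heval : ∀ i, MvPolynomial.eval (Sum.elim x (cexp ∘ x)) (f i) = 0)
    (hdet : (Matrix.of fun i j => MvPolynomial.eval (Sum.elim x (cexp ∘ x)) (expPDeriv j (f i))).det ≠ 0) :
    ∃ Y : Finset ℂ, (↑Y : Set ℂ) ⊆ (E : Set ℂ) ∧
      ∀ T : Finset ℂ, Y ⊆ T → ∀ (r : ℕ) (ρ : Fin r → Fin n),
        (∀ j, x j ∈ Submodule.span ℚ ((↑T : Set ℂ) ∪ Set.range (x ∘ ρ))) →
        Algebra.trdeg ↥(adjoin ℚ ((↑T : Set ℂ) ∪ cexp '' ↑T))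
          ↥(adjoin ↥(adjoin ℚ ((↑T : Set ℂ) ∪ cexp '' ↑T)) (Set.range x ∪ Set.range (cexp ∘ x))) ≤ r := by
  classical
  refine ⟨Y, hY, fun T hYT k ρ hspan => ?_⟩
  set Λ : Submodule ℚ ℂ := Submodule.span ℚ (↑T : Set ℂ) with hΛ
  have hTΛ : (↑T : Set ℂ) ⊆ (Λ : Set ℂ) := Submodule.subset_span
  have hYT' : (↑Y : Set ℂ) ⊆ (↑T : Set ℂ) := Finset.coe_subset.mpr hYT
  have hS : ((↑Y : Set ℂ) ∪ cexp '' ↑Y) ⊆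
      (Literature.NumberTheory.Transcendental.GammaField.fieldOf Λ : Set ℂ) := by
    rintro u (hu | ⟨y, hy, rfl⟩)
    · exact Literature.NumberTheory.Transcendental.GammaField.mem_fieldOf_of_mem (hTΛ (hYT' hu))
    · exact Literature.NumberTheory.Transcendental.GammaField.exp_mem_fieldOf (hTΛ (hYT' hy))
  have hspan' : ∀ j, x j ∈ Λ ⊔ Submodule.span ℚ (Set.range (x ∘ ρ)) := fun j => by
    rw [hΛ, ← Submodule.span_union]; exact hspan j
  have key := Literature.NumberTheory.Transcendental.KhovanskiiBound.trdeg_adjoin_le_of_khovanskii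
    Λ hS hcoeff heval hdet hspan'
  -- `key : trdeg_L L(x, e^x) ≤ k` for `L = fieldOf Λ = ℚ(gens Λ)`; pull down to `ℚ(T, e^T)`
  have hsub : ((↑T : Set ℂ) ∪ cexp '' ↑T) ⊆ Literature.NumberTheory.Transcendental.GammaField.gens Λ := by
    rintro u (hu | ⟨y, hy, rfl⟩)
    · exact Literature.NumberTheory.Transcendental.GammaField.mem_gens_of_mem (hTΛ hu)
    · exact Literature.NumberTheory.Transcendental.GammaField.exp_mem_gens (hTΛ hy)
  have hfO : Literature.NumberTheory.Transcendental.GammaField.fieldOf Λ =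
      adjoin ℚ (((↑T : Set ℂ) ∪ cexp '' ↑T) ∪
        Literature.NumberTheory.Transcendental.GammaField.gens Λ) := by
    rw [Set.union_eq_right.mpr hsub]; rfl
  have halg : ∀ u ∈ Literature.NumberTheory.Transcendental.GammaField.gens Λ,
      IsAlgebraic (adjoin ℚ ((↑T : Set ℂ) ∪ cexp '' ↑T)) u := by
    rintro u (hu | ⟨y, hy, rfl⟩)
    · exact isAlgebraic_algebraMap (⟨u, (mem_and_isAlgebraic_exp_of_mem_span_set hu _ le_rfl).1⟩ :
        ↥(adjoin ℚ ((↑T : Set ℂ) ∪ cexp '' ↑T)))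
    · exact (mem_and_isAlgebraic_exp_of_mem_span_set hy _ le_rfl).2
  have hdown := reltrdeg_le_of_isAlgebraic ((↑T : Set ℂ) ∪ cexp '' ↑T)
    (Literature.NumberTheory.Transcendental.GammaField.gens Λ)
    (Set.range x ∪ Set.range (cexp ∘ x)) halg (trdeg_witnessField_lt_aleph0 T)
  rw [← hfO] at hdown
  exact hdown.trans key

/-! ### §2 Membership in block steps and block hulls (the items' literal vocabulary) -/

/-- The coordinates of such a solution lie in the `N`-BLOCK STEP of `E` — `E ⊔ span_ℚ{coordinates of
tuples of size ≤ N satisfying the clause over E}` — for every `N ≥ n`. -/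
theorem mem_blockStep_of_khovanskii {E : Submodule ℚ ℂ} (Y : Finset ℂ) (hY : (↑Y : Set ℂ) ⊆ (E : Set ℂ))
    {n : ℕ} {x : Fin n → ℂ} {f : Fin n → MvPolynomial (Fin n ⊕ Fin n) ℂ}
    (hcoeff : ∀ i m, (f i).coeff m ∈ Subring.closure ((↑Y : Set ℂ) ∪ cexp '' ↑Y))
    (heval : ∀ i, MvPolynomial.eval (Sum.elim x (cexp ∘ x)) (f i) = 0)
    (hdet : (Matrix.of fun i j => MvPolynomial.eval (Sum.elim x (cexp ∘ x)) (expPDeriv j (f i))).det ≠ 0)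
    {N : ℕ} (hn : n ≤ N) (i : Fin n) :
    x i ∈ E ⊔ Submodule.span ℚ {u : ℂ | ∃ N' : ℕ, N' ≤ N ∧ ∃ w : Fin N' → ℂ,
      (∃ Y : Finset ℂ, (↑Y : Set ℂ) ⊆ (E : Set ℂ) ∧
        ∀ T : Finset ℂ, Y ⊆ T → ∀ (r : ℕ) (ρ : Fin r → Fin N'),
          (∀ j, w j ∈ Submodule.span ℚ ((↑T : Set ℂ) ∪ Set.range (w ∘ ρ))) →
          Algebra.trdeg ↥(adjoin ℚ ((↑T : Set ℂ) ∪ cexp '' ↑T))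
            ↥(adjoin ↥(adjoin ℚ ((↑T : Set ℂ) ∪ cexp '' ↑T)) (Set.range w ∪ Set.range (cexp ∘ w))) ≤ r) ∧
      u ∈ Set.range w} :=
  Submodule.mem_sup_right (Submodule.subset_span
    ⟨n, hn, x, hblock_of_khovanskii Y hY hcoeff heval hdet, ⟨i, rfl⟩⟩)

/-- … hence in the `N`-BLOCK HULL `⨆ₘ step^[m+1] E'` of every `E' ≥ E` (level `0`). -/
theorem mem_blockHull_of_khovanskii {E E' : Submodule ℚ ℂ} (hEE' : E ≤ E') (Y : Finset ℂ)
    (hY : (↑Y : Set ℂ) ⊆ (E : Set ℂ))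
    {n : ℕ} {x : Fin n → ℂ} {f : Fin n → MvPolynomial (Fin n ⊕ Fin n) ℂ}
    (hcoeff : ∀ i m, (f i).coeff m ∈ Subring.closure ((↑Y : Set ℂ) ∪ cexp '' ↑Y))
    (heval : ∀ i, MvPolynomial.eval (Sum.elim x (cexp ∘ x)) (f i) = 0)
    (hdet : (Matrix.of fun i j => MvPolynomial.eval (Sum.elim x (cexp ∘ x)) (expPDeriv j (f i))).det ≠ 0)
    {N : ℕ} (hn : n ≤ N) (i : Fin n) :
    x i ∈ ⨆ m : ℕ, (fun F : Submodule ℚ ℂ => F ⊔ Submodule.span ℚ {u : ℂ | ∃ N' : ℕ, N' ≤ N ∧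
      ∃ w : Fin N' → ℂ, (∃ Y : Finset ℂ, (↑Y : Set ℂ) ⊆ (F : Set ℂ) ∧
        ∀ T : Finset ℂ, Y ⊆ T → ∀ (r : ℕ) (ρ : Fin r → Fin N'),
          (∀ j, w j ∈ Submodule.span ℚ ((↑T : Set ℂ) ∪ Set.range (w ∘ ρ))) →
          Algebra.trdeg ↥(adjoin ℚ ((↑T : Set ℂ) ∪ cexp '' ↑T))
            ↥(adjoin ↥(adjoin ℚ ((↑T : Set ℂ) ∪ cexp '' ↑T)) (Set.range w ∪ Set.range (cexp ∘ w))) ≤ r) ∧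
      u ∈ Set.range w})^[m + 1] E' := by
  have h0 := mem_blockStep_of_khovanskii (E := E') Y (hY.trans (SetLike.coe_subset_coe.mpr hEE'))
    hcoeff heval hdet hn i
  refine (le_iSup_of_le (f := fun m : ℕ => (fun F : Submodule ℚ ℂ => F ⊔ Submodule.span ℚ {u : ℂ |
      ∃ N' : ℕ, N' ≤ N ∧ ∃ w : Fin N' → ℂ, (∃ Y : Finset ℂ, (↑Y : Set ℂ) ⊆ (F : Set ℂ) ∧
        ∀ T : Finset ℂ, Y ⊆ T → ∀ (r : ℕ) (ρ : Fin r → Fin N'),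
          (∀ j, w j ∈ Submodule.span ℚ ((↑T : Set ℂ) ∪ Set.range (w ∘ ρ))) →
          Algebra.trdeg ↥(adjoin ℚ ((↑T : Set ℂ) ∪ cexp '' ↑T))
            ↥(adjoin ↥(adjoin ℚ ((↑T : Set ℂ) ∪ cexp '' ↑T)) (Set.range w ∪ Set.range (cexp ∘ w))) ≤ r) ∧
      u ∈ Set.range w})^[m + 1] E') 0 le_rfl) ?_
  simpa only [zero_add, Function.iterate_one] using h0

/-! ### §3 K₃'s base: Khovanskii pairs over the curve hull lie in the pair hull `𝓚₂` (literal) -/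

/-- **Certified members of the residual's base.** With `𝓚` the route's curve hull of the EL-span and
`𝓚₂ = ⨆ₙ (pair step)^[n+1] 𝓚` its pair hull — both verbatim as in items stmt-Schanuel-30522/30523 —
every coordinate of a non-degenerate solution of an `n × n` exponential-polynomial system, `n ≤ 2`,
with coefficients in `ℤ[Y, e^Y]` for a finite `Y ⊂ 𝓚`, lies in `𝓚₂`. (Examples: the generic solution
of `e^x = x + y ∧ e^y = x·y`; any non-degenerate solution of `e^x + e^y = 1 + c·x ∧ x·e^y = y + e^x`
with `c ∈ ℤ[π, log 2]`.) -/
theorem mem_pairHull_curveHull_of_khovanskii (Y : Finset ℂ)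
    (hY : (↑Y : Set ℂ) ⊆ ↑(⨆ n : ℕ, (fun E : Submodule ℚ ℂ => E ⊔ Submodule.span ℚ {g : ℂ | ∃ Y : Finset ℂ, (↑Y : Set ℂ) ⊆ ↑E ∧ Algebra.trdeg ↥(IntermediateField.adjoin ℚ ((↑Y : Set ℂ) ∪ Complex.exp '' ↑Y)) ↥(IntermediateField.adjoin ↥(IntermediateField.adjoin ℚ ((↑Y : Set ℂ) ∪ Complex.exp '' ↑Y)) ({g, Complex.exp g} : Set ℂ)) ≤ 1})^[n + 1] (⨆ n : ℕ, (fun E : Submodule ℚ ℂ => (E ⊔ Submodule.span ℚ (Complex.exp '' ↑E)) ⊔ Submodule.span ℚ (Complex.exp ⁻¹' ↑(E ⊔ Submodule.span ℚ (Complex.exp '' ↑E))))^[n + 1] (Submodule.span ℚ ({z : ℂ | IsAlgebraic ℚ z} ∪ {z : ℂ | ∃ β l : ℂ, IsAlgebraic ℚ β ∧ IsAlgebraic ℚ (Complex.exp l) ∧ z = β * l})))))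
    {n : ℕ} (hn2 : n ≤ 2) {x : Fin n → ℂ} {f : Fin n → MvPolynomial (Fin n ⊕ Fin n) ℂ}
    (hcoeff : ∀ i m, (f i).coeff m ∈ Subring.closure ((↑Y : Set ℂ) ∪ cexp '' ↑Y))
    (heval : ∀ i, MvPolynomial.eval (Sum.elim x (cexp ∘ x)) (f i) = 0)
    (hdet : (Matrix.of fun i j => MvPolynomial.eval (Sum.elim x (cexp ∘ x)) (expPDeriv j (f i))).det ≠ 0)
    (i : Fin n) :
    x i ∈ (⨆ n : ℕ, (fun E : Submodule ℚ ℂ => E ⊔ Submodule.span ℚ {x : ℂ | ∃ N : ℕ, N ≤ 2 ∧ ∃ w : Fin N → ℂ, (∃ Y : Finset ℂ, (↑Y : Set ℂ) ⊆ ↑E ∧ ∀ T : Finset ℂ, Y ⊆ T → ∀ (r : ℕ) (ρ : Fin r → Fin N), (∀ j, w j ∈ Submodule.span ℚ ((↑T : Set ℂ) ∪ Set.range (w ∘ ρ))) → Algebra.trdeg ↥(IntermediateField.adjoin ℚ ((↑T : Set ℂ) ∪ Complex.exp '' ↑T)) ↥(IntermediateField.adjoin ↥(IntermediateField.adjoin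 ℚ ((↑T : Set ℂ) ∪ Complex.exp '' ↑T)) (Set.range w ∪ Set.range (Complex.exp ∘ w))) ≤ r) ∧ x ∈ Set.range w})^[n + 1] (⨆ n : ℕ, (fun E : Submodule ℚ ℂ => E ⊔ Submodule.span ℚ {g : ℂ | ∃ Y : Finset ℂ, (↑Y : Set ℂ) ⊆ ↑E ∧ Algebra.trdeg ↥(IntermediateField.adjoin ℚ ((↑Y : Set ℂ) ∪ Complex.exp '' ↑Y)) ↥(IntermediateField.adjoin ↥(IntermediateField.adjoin ℚ ((↑Y : Set ℂ) ∪ Complex.exp '' ↑Y)) ({g, Complex.exp g} : Set ℂ)) ≤ 1})^[n + 1] (⨆ n : ℕ, (fun E : Submodule ℚ ℂ => (E ⊔ Submodule.span ℚ (Complex.exp '' ↑E)) ⊔ Submodule.span ℚ (Complex.exp ⁻¹' ↑(E ⊔ Submodule.span ℚ (Complex.exp '' ↑E))))^[n + 1] (Submodule.span ℚ ({z : ℂ | IsAlgebraic ℚ z} ∪ {z : ℂ | ∃ β l : ℂ, IsAlgebraic ℚ β ∧ IsAlgebraic ℚ (Complex.exp l) ∧ z = β * l}))))) :=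
  mem_blockHull_of_khovanskii le_rfl Y hY hcoeff heval hdet hn2 i

/-! ### §4 Every exponentially algebraic number is a coordinate of a hereditary block over `ℚ·0 = ⊥`
(the kernel of NODE v9's exhaustion `ecl ∅ = ⋃_N 𝓚_N(⊥)`) -/

/-- For `a ∈ ecl ∅` (Kirby's exponential-algebraic closure of `∅` in `ℂ_exp`,
`Literature.NumberTheory.Transcendental.ecl`): `a` is a coordinate of a tuple satisfying the
hereditary-block clause over `⊥` (witness set `∅`). -/
theorem exists_hblock_of_mem_ecl_empty {a : ℂ}
    (ha : a ∈ Literature.NumberTheory.Transcendental.ecl (∅ : Set ℂ)) :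
    ∃ (n : ℕ) (x : Fin n → ℂ), a ∈ Set.range x ∧
      ∃ Y : Finset ℂ, (↑Y : Set ℂ) ⊆ ((⊥ : Submodule ℚ ℂ) : Set ℂ) ∧
        ∀ T : Finset ℂ, Y ⊆ T → ∀ (r : ℕ) (ρ : Fin r → Fin n),
          (∀ j, x j ∈ Submodule.span ℚ ((↑T : Set ℂ) ∪ Set.range (x ∘ ρ))) →
          Algebra.trdeg ↥(adjoin ℚ ((↑T : Set ℂ) ∪ cexp '' ↑T))
            ↥(adjoin ↥(adjoin ℚ ((↑T : Set ℂ) ∪ cexp '' ↑T)) (Set.range x ∪ Set.range (cexp ∘ x))) ≤ r := by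
  obtain ⟨n, x, f, hax, hcoeff, heval, hdet⟩ := ha
  exact ⟨n, x, hax, hblock_of_khovanskii (E := ⊥) (f := f) ∅ (by simp)
    (fun i m => by simpa using hcoeff i m) heval hdet⟩

end Summit.Schanuel.Schanuel.Theorems.RootDecomp1JKhovanskiiBlocks

end
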